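import Summits.ResolutionOfSingularities.ResolutionOfSingularities.Theorems.EquisingularLiftEquisingularLiftNatConormalFrameOfGenerators
import Summits.ResolutionOfSingularities.ResolutionOfSingularities.Theorems.EquisingularLiftEquisingularLiftNatDirLiftRankAdditive
import Summits.ResolutionOfSingularities.ResolutionOfSingularities.Theorems.EquisingularLiftEquisingularLiftNatDirectionChartData
import Summits.ResolutionOfSingularities.ResolutionOfSingularities.Theorems.EquisingularLiftEquisingularLiftNatDirZeroDefs
import Literature.AlgebraicGeometry.Modules.PullbackFrame
import HarnessLib

/-!
# [OURS · L1 W4.5(b) · EL♮(3)] T-DIRLIFT-UP (L) — glue for the `hQ` socket: the doubly pulled-back conormal bundle has rank 2;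
# the inclusion `Γ̃₁ ↪ Ẽ₁`

Crux chain w45b (cell `res-hironaka`, slot W4.5(b)), child crux **EL♮(3)** = stmt-ResolutionOfSingularities-20148, route EquisingularLift; object (L)
(res-L1-w45b-stub-4 g9, skeleton `L/res-L1-w45b-stub-4/DirLiftSkeleton-v4.lean`): two inputs of res-L1-w45b-lead-2's C2 assembly
`subsingleton_cechMH1_sheafHom_Dplus_of_dirStepUnobs` supplied from the skeleton's context. HONEST FRAMING: OURS; NOT a statement of any
manuscript; AI-written, weaker than expert review. No `sorry`; standard axioms; DEF-FREE. `--supports stmt-ResolutionOfSingularities-20148 --as helper`.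

* `hasRank_pullback_pullback_conormalSheaf_two` — `HasRank (g^* ε^* 𝒞_{V(I)}) 2` for a codimension-2 regular immersion `V(I) ↪ X₀` (frames from
  res-rescue-typ-5's `exists_conormalFrame_of_generators` p586543, pulled back twice, `FrameSystem.hasRank`);
* `exists_redSub_inclusion` — the inclusion `i₁ : Γ̃₁ ⟶ Ẽ₁` over `G₁` along `Γ₁ ⊆ E₁` (Mathlib `IdealSheafData.inclusion` of `𝓘⟨E₁⟩ ≤ 𝓘⟨Γ₁⟩`).

References (method): U. Görtz, T. Wedhorn, *Algebraic Geometry II* (2023), Rem. 19.22; R. Hartshorne, *Algebraic Geometry* (1977), II.5 (p. 110).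
-/

set_option linter.dupNamespace false

noncomputable section

open CategoryTheory CategoryTheory.Limits AlgebraicGeometry TopologicalSpace Topology IsLocalRing Opposite
open Literature.AlgebraicGeometry.Resolution
open Literature.AlgebraicGeometry.Modules Literature.AlgebraicGeometry.Motives
open Literature.AlgebraicGeometry.Deformation Literature.AlgebraicGeometry.HodgeTheory
open AlgebraicGeometry.Scheme.IdealSheafData

namespace Summit.ResolutionOfSingularities.ResolutionOfSingularities.Cruxes.EquisingularLiftNat.Sections

open Summit.ResolutionOfSingularities.ResolutionOfSingularities.Cruxes.EquisingularLiftNat.P1VB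

/-- **The doubly pulled-back conormal bundle of a codimension-2 regular immersion has rank 2.** For `V(I) ↪ X₀` a regular immersion of
codimension 2 (`X₀` locally Noetherian) and any `Y' —g→ Y —ε→ V(I)`, the module `g^* ε^* 𝒞_{V(I)}` has rank 2: the conormal frames on the charts
of the definition (res-rescue-typ-5's `exists_conormalFrame_of_generators`) pull back to frames of size 2 near every point.
[cite: GortzWedhorn2023, Rem. 19.22] [cite: Hartshorne1977, II.5 (p. 110)] [OURS · L1 W4.5b · (L) glue] -/
theorem hasRank_pullback_pullback_conormalSheaf_two {X₀ Y Y' : Scheme.{0}} [IsLocallyNoetherian X₀] (I : X₀.IdealSheafData)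
    (hri : IsRegularImmersionOfCodim I.subschemeι 2) (ε : Y ⟶ I.subscheme) (g : Y' ⟶ Y) :
    HasRank ((Scheme.Modules.pullback g).obj ((Scheme.Modules.pullback ε).obj (conormalSheaf I.subschemeι))) 2 := by
  classical
  haveI : IsClosedImmersion I.subschemeι := inferInstance
  have hfr : ∀ y : Y', ∃ (W : Y'.Opens) (_ : y ∈ W),
      Nonempty (SheafOfModules.free (Fin 2) ≅
        ((Scheme.Modules.pullback g).obj ((Scheme.Modules.pullback ε).obj (conormalSheaf I.subschemeι))).over W) := by
    intro y
    obtain ⟨V, hzV, rs, hlen, hreg, hIV⟩ := hri.2 (ε (g y))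
    obtain ⟨x0, x1, rfl⟩ := List.length_eq_two.mp hlen
    have hreg' : RingTheory.Sequence.IsWeaklyRegular Γ(X₀, (V : X₀.Opens)) (List.ofFn ![x0, x1]) := by
      rw [list_ofFn_pair]; exact hreg
    have hspan' : Ideal.span (Set.range ![x0, x1]) = I.subschemeι.ker.ideal V := by
      have h : I.subschemeι.ker.ideal V = Ideal.ofList [x0, x1] := hIV.symm
      rw [h, span_range_fin_two, Ideal.ofList_cons, Ideal.ofList_singleton, Ideal.span_insert]
      rfl
    obtain ⟨s, e, -, -⟩ := exists_conormalFrame_of_generators I.subschemeι V ![x0, x1] hreg' hspan'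
    exact ⟨g ⁻¹ᵁ (ε ⁻¹ᵁ (I.subschemeι ⁻¹ᵁ (V : X₀.Opens))), hzV, ⟨pullbackFrame g (pullbackFrame ε e)⟩⟩
  choose W hW e using hfr
  exact FrameSystem.hasRank
    { U := W
      mem := hW
      I := fun _ => Fin 2
      rank := fun _ => 2
      enum := fun _ => Equiv.refl _
      frame := fun y => (e y).some } 2 fun _ => rfl

/-- **The inclusion `Γ̃₁ ↪ Ẽ₁` of reduced closed subschemes along `Γ₁ ⊆ E₁`**, over `G₁`. [folklore] -/
theorem exists_redSub_inclusion {G₁ : Scheme.{0}} (E₁ : Set G₁) (hE₁ : IsClosed E₁) (Γ₁ : Set G₁) (hΓ₁ : IsClosed Γ₁) (h : Γ₁ ⊆ E₁) :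
    ∃ i₁ : redSub G₁ Γ₁ hΓ₁ ⟶ redSub G₁ E₁ hE₁, i₁ ≫ redSubι G₁ E₁ hE₁ = redSubι G₁ Γ₁ hΓ₁ :=
  ⟨Scheme.IdealSheafData.inclusion (vanishingIdeal_antimono (show (⟨Γ₁, hΓ₁⟩ : Closeds G₁) ≤ ⟨E₁, hE₁⟩ from h)),
    Scheme.IdealSheafData.inclusion_subschemeι _⟩

end Summit.ResolutionOfSingularities.ResolutionOfSingularities.Cruxes.EquisingularLiftNat.Sections

end
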